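import Mathlib
import HarnessLib
import Literature.MathematicalPhysics.QuantumFieldTheory.OSSectorContinuation
import Literature.MathematicalPhysics.QuantumFieldTheory.OSReconstructionNoE1Proofs
import Summits.QuantumFields.YangMills.Theorems.MirrorModularBoostsPlanarSpectralConeFrontEnd

/-!
# `TransparentRPWall.LabelledConeDiscSections` (stmt-QuantumFields-18618) — PROOF (candidate, strategist-written)

Piece 1 (FRONT END, labelled) of the crux-strategist split of `TransparentRPWall.LabelledPlanarSpectralCone`
(stmt-QuantumFields-9910): for a labelled Schwinger family `S` over any label type `ι` on `ℝ⁴`, translation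
invariant on `⁰𝒮` and reflection positive in pull-back form for the eight frames of the `(x₀,x₁)`-plane,
`h` its `e₀` OS reconstruction and `G` a strict cone chain with label string `k`, the diagonal matrix
element `b ↦ ⟪Ψ_G^k, e^{-tH} U(b e₁) Ψ_G^k⟫` has, for every `t > 0`, a holomorphic extension to the disc
of radius `t` bounded by ONE constant (delay `c = 0`).

This is the LABELLED PORT of the landed one-species front end `stub_discSections` of the proved sibling
`MirrorModularBoosts.PlanarSpectralCone` (stmt-QuantumFields-9664): `frames_labelled` (= `stub_coneChainFrames`
with the pulled-back LABELLED reconstructions), `sectorData_labelled` (= `FrontEnd.coneSectorData` with label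
strings; slots by the label-generic `stub_complexTimeSlot`), `thales_labelled`
(= `stub_discSections_of_sectorExtension` with the labelled read-back
`pairing_eq_inner_transfer_translate_labelled`), and the glue `labelledConeDiscSections_proof` (sector
engine `IsSectorData.exists_extension` + maximum principle `norm_extension_le` + Thales). Every label-free
lemma is the tree's, by name. The statement is INLINE (verbatim the body of the route decl
`Summit.QuantumFields.QCD.Theses.TransparentRPWall.LabelledConeDiscSections`), so the file imports no route
file and a prover can land it verbatim under `Summits/QuantumFields/QCD/Theorems/` (`--workitem
stmt-QuantumFields-18618`); the gate's accept-time probe matches the decl by its definiens.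
Written by planner-cstrat-stmt-QuantumFields-9910-r1-0 (lean check rc 0, 0 sorries). [folklore]
-/


noncomputable section

namespace Summit.QuantumFields.QCD.Theorems.LabelledConeDiscSectionsProof

open MeasureTheory Complex Set Filter
open scoped InnerProductSpace SchwartzMap ComplexConjugate
open Literature.MathematicalPhysics.QuantumLattice Literature.MathematicalPhysics.AQFT
  Literature.MathematicalPhysics.QuantumFieldTheory
open Summit.QuantumFields.YangMills.Cruxes.PlanarSpectralCone.TwoMirrorLightconeSlots
open Summit.QuantumFields.YangMills.Cruxes.PlanarSpectralCone.PositivityDiscToOperatorCone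

/-- Euclidean `ℝ⁴`, time = coordinate `0`, the boost plane = coordinates `0, 1`. -/
local notation "E4" => EuclideanSpace ℝ (Fin 4)

/-! ## The three steps (labelled ports) -/

/-- **Stub 1 — FRAMES (labelled `stub_coneChainFrames`).** For a labelled family `S` translation
invariant on `⁰𝒮` with the eight-frame pull-back RP and a cone chain `G`, the two `±45°` frames
`R₊, R₋` of the `(x₀,x₁)`-plane have pulled-back LABELLED families satisfying `OSReconstructionNoE1`,
and e₀-time-ordered `A±, B±` with `ΘG* ⊗ G_{a(u,u')} = linActMulti R₊ (ΘA₊* ⊗ (B₊)_{u e₀ − u' e₁})`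
`= linActMulti R₋ (ΘA₋* ⊗ (B₋)_{u' e₀ + u e₁})`. -/
theorem frames_labelled {ι : Type} (S : LabelledSchwingerFamily ι E4)
    (hT : ∀ (n : ℕ) (k : Fin n → ι) (a : E4) (F : SchwartzMap (Fin n → E4) ℂ), IsOffDiagonal F →
      S n k (translateMulti a F) = S n k F)
    (hRP : ∀ (R : E4 ≃ₗᵢ[ℝ] E4) (a b : ℝ), a ^ 2 + b ^ 2 = 1 → (a = 0 ∨ b = 0 ∨ a ^ 2 = b ^ 2) →
      R (EuclideanSpace.single 0 1) = a • EuclideanSpace.single 0 1 + b • EuclideanSpace.single 1 1 →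
      LabelledSchwingerFamily.IsReflectionPositive (fun n (k : Fin n → ι) => (S n k).comp (linActMulti R)))
    {m : ℕ} (G : SchwartzMap (Fin m → E4) ℂ)
    (hGcone : tsupport (G : (Fin m → E4) → ℂ) ⊆
      {x | (∀ i, |x i 1| < x i 0) ∧ ∀ i j, i < j → |x j 1 - x i 1| < x j 0 - x i 0}) :
    ∃ (Rp Rm : E4 ≃ₗᵢ[ℝ] E4) (Ap Bp Am Bm : SchwartzMap (Fin m → E4) ℂ),
      IsTimeOrdered Ap ∧ IsTimeOrdered Bp ∧ IsTimeOrdered Am ∧ IsTimeOrdered Bm ∧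
      OSReconstructionNoE1 (fun n (k : Fin n → ι) => (S n k).comp (linActMulti Rp)) ∧
      OSReconstructionNoE1 (fun n (k : Fin n → ι) => (S n k).comp (linActMulti Rm)) ∧
      (∀ u u' : ℝ, (osAdjoint G).appendTensor
          (translateMulti (((u + u') / Real.sqrt 2) • EuclideanSpace.single 0 1 +
            ((u - u') / Real.sqrt 2) • EuclideanSpace.single 1 1) G) =
        linActMulti Rp ((osAdjoint Ap).appendTensor
          (translateMulti (u • EuclideanSpace.single 0 1 + (-u') • EuclideanSpace.single 1 1) Bp))) ∧
      (∀ u u' : ℝ, (osAdjoint G).appendTensor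
          (translateMulti (((u + u') / Real.sqrt 2) • EuclideanSpace.single 0 1 +
            ((u - u') / Real.sqrt 2) • EuclideanSpace.single 1 1) G) =
        linActMulti Rm ((osAdjoint Am).appendTensor
          (translateMulti (u' • EuclideanSpace.single 0 1 + u • EuclideanSpace.single 1 1) Bm))) := by
  obtain ⟨Rp, hp0, hp1, hp0', -, hpi, hpθ, hpe⟩ := exists_diagFrame 1 (Or.inl rfl)
  obtain ⟨Rm, hm0, hm1, hm0', -, hmi, hmθ, hme⟩ := exists_diagFrame (-1) (Or.inr rfl)
  have hsq : Real.sqrt 2 ^ 2 = 2 := Real.sq_sqrt zero_le_two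
  have hle : ∀ r : ℝ, 1 * r ≤ |r| := fun r => by rw [one_mul]; exact le_abs_self r
  have hle' : ∀ r : ℝ, -1 * r ≤ |r| := fun r => by rw [neg_one_mul]; exact neg_le_abs r
  have hab : (1 / Real.sqrt 2) ^ 2 + (1 / Real.sqrt 2) ^ 2 = 1 := by
    rw [div_pow, one_pow, hsq]; norm_num
  have hab' : (1 / Real.sqrt 2) ^ 2 + (-1 / Real.sqrt 2) ^ 2 = 1 := by
    rw [div_pow, div_pow, one_pow, hsq]; norm_num
  have h8' : (1 / Real.sqrt 2) ^ 2 = (-1 / Real.sqrt 2) ^ 2 := by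
    rw [div_pow, div_pow]; norm_num
  -- `OSReconstructionNoE1` of a pulled-back LABELLED family
  have pull : ∀ (R : E4 ≃ₗᵢ[ℝ] E4) (a b : ℝ), a ^ 2 + b ^ 2 = 1 → (a = 0 ∨ b = 0 ∨ a ^ 2 = b ^ 2) →
      R (EuclideanSpace.single 0 1) = a • EuclideanSpace.single 0 1 + b • EuclideanSpace.single 1 1 →
      OSReconstructionNoE1 (fun n (k : Fin n → ι) => (S n k).comp (linActMulti R)) := by
    intro R a b hab₀ h8 hR
    refine ⟨hRP R a b hab₀ h8 hR, fun n k c F hF => ?_⟩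
    show S n k (linActMulti R (translateMulti c F)) = S n k (linActMulti R F)
    rw [linActMulti_translateMulti]
    exact hT n k (R c) _ (isOffDiagonal_linActMulti_four hF R)
  refine ⟨Rp, Rm, linActMulti Rp G, linActMulti Rp.symm G, linActMulti Rm G, linActMulti Rm.symm G,
    ?_, ?_, ?_, ?_, ?_, ?_, fun u u' => ?_, fun u u' => ?_⟩
  · exact isTimeOrdered_linActMulti_of_cone Rp (-1) hle' (fun x => by rw [hp0]; ring) G hGcone
  · exact isTimeOrdered_linActMulti_of_cone Rp.symm 1 hle hp0' G hGcone
  · exact isTimeOrdered_linActMulti_of_cone Rm 1 hle (fun x => by rw [hm0]; ring) G hGcone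
  · exact isTimeOrdered_linActMulti_of_cone Rm.symm (-1) hle' hm0' G hGcone
  · exact pull Rp _ _ hab (Or.inr (Or.inr rfl)) hpe
  · exact pull Rm _ _ hab' (Or.inr (Or.inr h8')) hme
  · have hv : Rp (u • EuclideanSpace.single 0 1 + (-u') • EuclideanSpace.single 1 1) =
        ((u + u') / Real.sqrt 2) • EuclideanSpace.single 0 1 +
          ((u - u') / Real.sqrt 2) • EuclideanSpace.single 1 1 := by
      ext i
      fin_cases i
      · simp [hp0]; ring
      · simp [hp1]; ring
      · simp [(hpi _ 2 (by decide) (by decide)).1]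
      · simp [(hpi _ 3 (by decide) (by decide)).1]
    rw [← hv]
    exact pairing_pullback Rp hpθ G _
  · have hv : Rm (u' • EuclideanSpace.single 0 1 + u • EuclideanSpace.single 1 1) =
        ((u + u') / Real.sqrt 2) • EuclideanSpace.single 0 1 +
          ((u - u') / Real.sqrt 2) • EuclideanSpace.single 1 1 := by
      ext i
      fin_cases i
      · simp [hm0]; ring
      · simp [hm1]; ring
      · simp [(hmi _ 2 (by decide) (by decide)).1]
      · simp [(hmi _ 3 (by decide) (by decide)).1]
    rw [← hv]
    exact pairing_pullback Rm hmθ G _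

/-- **Read-back of a translated LABELLED pairing**: for time-ordered `A` (labels `k`), `B` (labels
`k'`) in the OS space of a labelled family `S'`,
`𝔖'_{n+m}^{rev k ++ k'}(ΘA* ⊗ B_{t e₀ + b e₁}) = ⟪Ψ_A^k, e^{-tH} U(b e₁) Ψ_B^{k'}⟫` (`t ≥ 0`). -/
theorem pairing_eq_inner_transfer_translate_labelled {ι : Type} (S' : LabelledSchwingerFamily ι E4)
    (h' : OSReconstructionNoE1 S')
    {n m : ℕ} (k : Fin n → ι) (k' : Fin m → ι) (A : SchwartzMap (Fin n → E4) ℂ) (B : SchwartzMap (Fin m → E4) ℂ)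
    (hA : IsTimeOrdered A) (hB : IsTimeOrdered B) {t : ℝ} (ht : 0 ≤ t) (b : ℝ) :
    S' (n + m) (Fin.append (k ∘ Fin.rev) k') ((osAdjoint A).appendTensor
        (translateMulti (t • EuclideanSpace.single 0 1 + b • EuclideanSpace.single 1 1) B)) =
      ⟪h'.fieldVec n k A hA,
        h'.transfer t (h'.translate (b • EuclideanSpace.single 1 1) (h'.fieldVec m k' B hB))⟫_ℂ := by
  rw [OSReconstructionNoE1.translate_fieldVec, OSReconstructionNoE1.transfer_fieldVec _ ht]
  have hH : IsAppendTensorOf ((osAdjoint A).appendTensor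
      (translateMulti (t • EuclideanSpace.single 0 1 + b • EuclideanSpace.single 1 1) B)) (osAdjoint A)
      (translateMulti (SchwingerFamily.timeVec t)
        (translateMulti (spatialPart 0 (b • (EuclideanSpace.single 1 1 : E4))) B)) := by
    rw [DiscSections.translateMulti_time_space]; exact isAppendTensorOf_appendTensor _ _
  rw [h'.inner_fieldVec_fieldVec k k' hA _ hH]

/-- **Stub 2 — SECTOR DATA (labelled `FrontEnd.coneSectorData`).** From the frame data of stub 1,
the function `φ_G^k(u,u') = 𝔖_{2m}^{rev k ++ k}(ΘG* ⊗ G_{a(u,u')})` with its two diagonal-semigroup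
slots is `LogSlot.IsSectorData (π/2) φ_G^k E M 0 (fun _ => M)`; the base bound `‖Ψ_G^k‖²` is read in
the `e₀` frame. -/
theorem sectorData_labelled {ι : Type} (S : LabelledSchwingerFamily ι E4) (h : OSReconstructionNoE1 S)
    {m : ℕ} (k : Fin m → ι) (G : SchwartzMap (Fin m → E4) ℂ) (hG : IsTimeOrdered G)
    (Rp Rm : E4 ≃ₗᵢ[ℝ] E4) (Ap Bp Am Bm : SchwartzMap (Fin m → E4) ℂ)
    (hAp : IsTimeOrdered Ap) (hBp : IsTimeOrdered Bp) (hAm : IsTimeOrdered Am) (hBm : IsTimeOrdered Bm)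
    (hp : OSReconstructionNoE1 (fun n (k : Fin n → ι) => (S n k).comp (linActMulti Rp)))
    (hm : OSReconstructionNoE1 (fun n (k : Fin n → ι) => (S n k).comp (linActMulti Rm)))
    (hidp : ∀ u u' : ℝ, (osAdjoint G).appendTensor
        (translateMulti (((u + u') / Real.sqrt 2) • EuclideanSpace.single 0 1 +
          ((u - u') / Real.sqrt 2) • EuclideanSpace.single 1 1) G) =
      linActMulti Rp ((osAdjoint Ap).appendTensor
        (translateMulti (u • EuclideanSpace.single 0 1 + (-u') • EuclideanSpace.single 1 1) Bp)))
    (hidm : ∀ u u' : ℝ, (osAdjoint G).appendTensor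
        (translateMulti (((u + u') / Real.sqrt 2) • EuclideanSpace.single 0 1 +
          ((u - u') / Real.sqrt 2) • EuclideanSpace.single 1 1) G) =
      linActMulti Rm ((osAdjoint Am).appendTensor
        (translateMulti (u' • EuclideanSpace.single 0 1 + u • EuclideanSpace.single 1 1) Bm))) :
    ∃ (M : ℝ) (E : Fin 2 → (Fin 1 → ℝ) → ℂ → ℂ),
      LogSlot.IsSectorData (Real.pi / 2)
        (fun u : Fin 2 → ℝ => S (m + m) (Fin.append (k ∘ Fin.rev) k) ((osAdjoint G).appendTensor
          (translateMulti (((u 0 + u 1) / Real.sqrt 2) • EuclideanSpace.single 0 1 +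
            ((u 0 - u 1) / Real.sqrt 2) • EuclideanSpace.single 1 1) G)))
        E M 0 (fun _ => M) := by
  -- the two complex-time slots in the pulled-back reconstructions
  obtain ⟨Cp, Ep, hEpd, hEpc, hEpb, hEpr⟩ :=
    stub_complexTimeSlot hp (hp.fieldVec m k Ap hAp) (hp.fieldVec m k Bp hBp)
  obtain ⟨Cm, Em, hEmd, hEmc, hEmb, hEmr⟩ :=
    stub_complexTimeSlot hm (hm.fieldVec m k Am hAm) (hm.fieldVec m k Bm hBm)
  set ψG := h.fieldVec m k G hG with hψG
  set M : ℝ := max (‖ψG‖ ^ 2) (max Cp Cm) with hM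
  set Sfun : (Fin 2 → ℝ) → ℂ := fun u => S (m + m) (Fin.append (k ∘ Fin.rev) k) ((osAdjoint G).appendTensor
    (translateMulti (((u 0 + u 1) / Real.sqrt 2) • EuclideanSpace.single 0 1 +
      ((u 0 - u 1) / Real.sqrt 2) • EuclideanSpace.single 1 1) G)) with hSfun
  set E : Fin 2 → (Fin 1 → ℝ) → ℂ → ℂ :=
    ![fun u' τ => Ep ((-(u' 0)) • EuclideanSpace.single 1 1) τ,
      fun u' τ => Em ((u' 0) • EuclideanSpace.single 1 1) τ] with hE
  have hM0 : 0 ≤ M := le_trans (by positivity) (le_max_left _ _)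
  -- base values in the e₀ frame
  have hbase : ∀ u : Fin 2 → ℝ, (∀ j, 0 < u j) → ‖Sfun u‖ ≤ ‖ψG‖ ^ 2 := by
    intro u hu
    have ht : 0 ≤ (u 0 + u 1) / Real.sqrt 2 := by
      have := hu 0; have := hu 1; positivity
    have e := pairing_eq_inner_transfer_translate_labelled S h k k G G hG hG ht
      ((u 0 - u 1) / Real.sqrt 2)
    simp only [hSfun]
    rw [e]
    calc ‖⟪ψG, h.transfer ((u 0 + u 1) / Real.sqrt 2)
            (h.translate (((u 0 - u 1) / Real.sqrt 2) • EuclideanSpace.single 1 1) ψG)⟫_ℂ‖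
        ≤ ‖ψG‖ * ‖h.transfer ((u 0 + u 1) / Real.sqrt 2)
            (h.translate (((u 0 - u 1) / Real.sqrt 2) • EuclideanSpace.single 1 1) ψG)‖ :=
          norm_inner_le_norm _ _
      _ ≤ ‖ψG‖ * ‖ψG‖ := by
          gcongr
          refine (h.norm_transfer_le _ _).trans ?_
          rw [LinearIsometryEquiv.norm_map]
      _ = ‖ψG‖ ^ 2 := by ring
  -- real values of the two slots
  have hreal_p : ∀ (x y : ℝ), 0 < x →
      Ep ((-y) • EuclideanSpace.single 1 1) (x : ℂ) = Sfun ![x, y] := by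
    intro x y hx
    rw [hEpr _ (by simp) x hx]
    simp only [hSfun, Matrix.cons_val_zero, Matrix.cons_val_one]
    rw [hidp x y]
    exact (pairing_eq_inner_transfer_translate_labelled (fun n κ => (S n κ).comp (linActMulti Rp)) hp
      k k Ap Bp hAp hBp hx.le (-y)).symm
  have hreal_m : ∀ (x y : ℝ), 0 < x →
      Em (y • EuclideanSpace.single 1 1) (x : ℂ) = Sfun ![y, x] := by
    intro x y hx
    rw [hEmr _ (by simp) x hx]
    simp only [hSfun, Matrix.cons_val_zero, Matrix.cons_val_one]
    rw [hidm y x]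
    exact (pairing_eq_inner_transfer_translate_labelled (fun n κ => (S n κ).comp (linActMulti Rm)) hm
      k k Am Bm hAm hBm hx.le y).symm
  refine ⟨M, E, ?_, hM0, ?_, ?_, ?_, fun _ => hM0, ?_, ?_⟩
  · -- continuity of φ_G^k on the open quadrant (translations are continuous on 𝒮)
    have hc := OSReconstructionNoE1.continuous_apply_appendTensor_translateMulti S
      ⟨m, k, G, hG⟩ ⟨m, k, G, hG⟩
    have hv : Continuous fun u : Fin 2 → ℝ =>
        (((u 0 + u 1) / Real.sqrt 2) • EuclideanSpace.single 0 1 +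
          ((u 0 - u 1) / Real.sqrt 2) • EuclideanSpace.single 1 1 : EuclideanSpace ℝ (Fin 4)) := by
      fun_prop
    exact (hc.comp hv).continuousOn
  · intro u hu
    rw [pow_zero, mul_one]
    exact (hbase u hu).trans (le_max_left _ _)
  · intro i τ hτ
    fin_cases i
    · simp only [hE, Fin.zero_eta, Fin.isValue, Matrix.cons_val_zero]
      exact ((hEpc τ hτ.1).comp (by fun_prop)).continuousOn
    · simp only [hE, Fin.mk_one, Fin.isValue, Matrix.cons_val_one, Matrix.cons_val_fin_one]
      exact ((hEmc τ hτ.1).comp (by fun_prop)).continuousOn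
  · intro i u' hu'
    fin_cases i
    · simpa [hE] using (hEpd _).mono fun τ hτ => hτ.1
    · simpa [hE] using (hEmd _).mono fun τ hτ => hτ.1
  · intro i c _ u' τ _ hτ _
    rw [pow_zero, pow_zero, mul_one, mul_one]
    fin_cases i
    · have := hEpb ((-(u' 0)) • EuclideanSpace.single 1 1) τ hτ
      simp only [hE, Fin.zero_eta, Fin.isValue, Matrix.cons_val_zero]
      exact this.trans ((le_max_left _ _).trans (le_max_right _ _))
    · have := hEmb ((u' 0) • EuclideanSpace.single 1 1) τ hτ
      simp only [hE, Fin.mk_one, Fin.isValue, Matrix.cons_val_one, Matrix.cons_val_fin_one]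
      exact this.trans ((le_max_right _ _).trans (le_max_right _ _))
  · intro i u' _ x hx
    fin_cases i
    · simp only [hE, Fin.zero_eta, Fin.isValue, Matrix.cons_val_zero]
      rw [hreal_p x (u' 0) hx]
      congr 1
      funext j
      fin_cases j
      · simp
      · simp
    · simp only [hE, Fin.mk_one, Fin.isValue, Matrix.cons_val_one, Matrix.cons_val_fin_one]
      rw [hreal_m x (u' 0) hx]
      have h0 : (1 : Fin 2).succAbove (0 : Fin 1) = 0 := by decide
      have h0' : Fin.insertNth (α := fun _ : Fin 2 => ℝ) (1 : Fin 2) x u' 0 = u' 0 := by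
        conv_lhs => rw [← h0]
        rw [Fin.insertNth_apply_succAbove]
      congr 1
      funext j
      fin_cases j
      · simp [h0']
      · simp

/-- **Stub 3 — THALES, labelled read-back (labelled `stub_discSections_of_sectorExtension`).** A
bounded holomorphic extension `Φ` of `φ_G^k` to the two-slot sector region gives, on every slice
`u + u' = √2 t`, a function holomorphic on the disc `|β| < t`, bounded by `M`, equal at real `b` to
`⟪Ψ_G^k, e^{-tH} U(b e₁) Ψ_G^k⟫`. -/
theorem thales_labelled {ι : Type} (S : LabelledSchwingerFamily ι E4) (h : OSReconstructionNoE1 S)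
    {m : ℕ} (k : Fin m → ι) (G : SchwartzMap (Fin m → E4) ℂ) (hG : IsTimeOrdered G)
    (M : ℝ) (Φ : (Fin 2 → ℂ) → ℂ)
    (hΦd : DifferentiableOn ℂ Φ (Literature.Analysis.Complex.sectorRegion 1 (Real.pi / 2)))
    (hΦb : ∀ w ∈ Literature.Analysis.Complex.sectorRegion 1 (Real.pi / 2), ‖Φ w‖ ≤ M)
    (hΦr : ∀ u : Fin 2 → ℝ, (∀ j, 0 < u j) →
      Φ (fun j => (u j : ℂ)) = S (m + m) (Fin.append (k ∘ Fin.rev) k) ((osAdjoint G).appendTensor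
        (translateMulti (((u 0 + u 1) / Real.sqrt 2) • EuclideanSpace.single 0 1 +
          ((u 0 - u 1) / Real.sqrt 2) • EuclideanSpace.single 1 1) G))) :
    ∀ t : ℝ, 0 < t → ∃ f : ℂ → ℂ, DifferentiableOn ℂ f (Metric.ball 0 t) ∧
      (∀ z ∈ Metric.ball (0 : ℂ) t, ‖f z‖ ≤ M) ∧
      ∀ b : ℝ, |b| < t → f b = ⟪h.fieldVec m k G hG,
        h.transfer t (h.translate (b • EuclideanSpace.single 1 1) (h.fieldVec m k G hG))⟫_ℂ := by
  intro t ht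
  -- the light-cone coordinate map of the slice `ζ = t`
  set g : ℂ → (Fin 2 → ℂ) := fun β =>
    (![((t : ℂ) + β) / (Real.sqrt 2 : ℂ), ((t : ℂ) - β) / (Real.sqrt 2 : ℂ)] : Fin 2 → ℂ) with hg
  have hmaps : MapsTo g (Metric.ball (0 : ℂ) t)
      (Literature.Analysis.Complex.sectorRegion 1 (Real.pi / 2)) := by
    intro β hβ
    rw [Metric.mem_ball, dist_zero_right] at hβ
    exact DiscSections.lightCone_mem_sectorRegion hβ
  have hgd : Differentiable ℂ g := DiscSections.differentiable_lightCone t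
  refine ⟨Φ ∘ g, hΦd.comp hgd.differentiableOn hmaps, fun z hz => hΦb _ (hmaps hz), ?_⟩
  intro b hb
  have hgb : g b = fun j =>
      (((![(t + b) / Real.sqrt 2, (t - b) / Real.sqrt 2] : Fin 2 → ℝ) j : ℝ) : ℂ) :=
    DiscSections.lightCone_ofReal t b
  show Φ (g b) = _
  rw [hgb, hΦr _ (DiscSections.lightCone_real_pos hb)]
  simp only [Matrix.cons_val_zero, Matrix.cons_val_one, Matrix.cons_val_fin_one]
  rw [DiscSections.lightCone_real_sum, DiscSections.lightCone_real_sub]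
  exact pairing_eq_inner_transfer_translate_labelled S h k k G G hG hG ht.le b

/-! ## The piece -/

/-- **THE PIECE FROM THE STUBS, BY NAME**: frames → sector data → the tree's sector engine and
maximum principle (`IsSectorData.exists_extension`, `norm_extension_le`) → Thales; delay `c = 0`. -/
theorem labelledConeDiscSections_proof :
    (open Literature.MathematicalPhysics.QuantumLattice Literature.MathematicalPhysics.AQFT Literature.MathematicalPhysics.QuantumFieldTheory in let E := EuclideanSpace ℝ (Fin 4); ∀ (ι : Type) (S : LabelledSchwingerFamily ι E), (∀ (n : ℕ) (k : Fin n → ι) (a : E) (F : SchwartzMap (Fin n → E) ℂ), IsOffDiagonal F → S n k (translateMulti a F) = S n k F) → (∀ (R : E ≃ₗᵢ[ℝ] E) (a b : ℝ), a ^ 2 + b ^ 2 = 1 → (a = 0 ∨ b = 0 ∨ a ^ 2 = b ^ 2) → R (EuclideanSpace.single 0 1) = a • EuclideanSpace.single 0 1 + b • EuclideanSpace.single 1 1 → LabelledSchwingerFamily.IsReflectionPositive (fun n (k : Fin n → ι) => (S n k).comp (linActMulti R))) → ∀ (h : OSReconstructionNoE1 S) (m : ℕ) (k : Fin m → ι)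 (G : SchwartzMap (Fin m → E) ℂ) (hG : IsTimeOrdered G), tsupport (G : (Fin m → E) → ℂ) ⊆ {x | (∀ i, |x i 1| < x i 0) ∧ ∀ i j, i < j → |x j 1 - x i 1| < x j 0 - x i 0} → ∃ c M : ℝ, 0 ≤ c ∧ ∀ t : ℝ, c < t → ∃ f : ℂ → ℂ, DifferentiableOn ℂ f (Metric.ball 0 (t - c)) ∧ (∀ z ∈ Metric.ball (0 : ℂ) (t - c), ‖f z‖ ≤ M) ∧ ∀ b : ℝ, |b| < t - c → f b = inner ℂ (h.fieldVec m k G hG) (h.transfer t (h.translate (EuclideanSpace.single 1 b) (h.fieldVec m k G hG)))) := by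
  intro E ι S htr hRP h m k G hG hC
  obtain ⟨Rp, Rm, Ap, Bp, Am, Bm, hAp, hBp, hAm, hBm, hp, hm, hidp, hidm⟩ := frames_labelled S htr hRP G hC
  obtain ⟨M, Esl, hdata⟩ := sectorData_labelled S h k G hG Rp Rm Ap Bp Am Bm hAp hBp hAm hBm hp hm hidp hidm
  -- the sector engine and the maximum principle on the flat tubes (through every opening `c < π/2`)
  obtain ⟨Φ, hΦd, hΦr⟩ := hdata.exists_extension (by positivity) le_rfl
  have hΦb : ∀ w ∈ Literature.Analysis.Complex.sectorRegion 1 (Real.pi / 2), ‖Φ w‖ ≤ M := by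
    intro w hw
    obtain ⟨c, hc1, hc2⟩ := exists_between hw.2
    have hc0 : 0 < c := lt_of_le_of_lt (Finset.sum_nonneg fun j _ => abs_nonneg _) hc1
    exact hdata.norm_extension_le le_rfl hΦd hΦr hc0 hc2
      (fun u hu => by simpa using hdata.bound u hu)
      (fun i u' τ hu' hτ hτc => by simpa using hdata.slot_bound i c hc2 u' τ hu' hτ hτc)
      ⟨hw.1, hc1⟩
  -- Thales on every slice, delay `c = 0`
  have hdisc := thales_labelled S h k G hG M Φ hΦd hΦb hΦr
  refine ⟨0, M, le_rfl, fun t ht => ?_⟩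
  obtain ⟨f, hf, hfM, hfb⟩ := hdisc t ht
  rw [sub_zero]
  refine ⟨f, hf, hfM, fun b hb => ?_⟩
  rw [hfb b hb, FrontEnd.single_one_eq_smul b]

end Summit.QuantumFields.QCD.Theorems.LabelledConeDiscSectionsProof

end
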